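import Literature.NumberTheory.EllipticCurves.KellerYin2024.HigherWeightAnalyticInvariants
import Summits.BirchSwinnertonDyer.Rank1Residual.X2.Cells
import HarnessLib

/-!
# Crux 4 `BSDpOnCellC` (stmt-BirchSwinnertonDyer-19034), line «crystal» (skeleton of record v8, LEAD `cruxlead-19034`):
# the REGISTERED stub `stub_memberInvariants` = (i) «`μ(𝓛^Σ_𝔭(g₁)) = 0`» ∧ (ii′) «the sign-free `λ`-count at the
# crystalline member», DERIVED VERBATIM from the two weight-`k` named statements of
# `Literature/NumberTheory/EllipticCurves/KellerYin2024/HigherWeightAnalyticInvariants.lean`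
# (Keller–Yin Thm. 2.2.2 `anacong` at weight `k = 2r` for the Hida member; x2-p2 g13)
# (cell `bsd-eis`, width seat `bsd-line-x2-p2` g13; `--supports stmt-BirchSwinnertonDyer-19034`; the skeleton is the LEAD's and is
# NOT touched here — W-79)

WHAT THIS GIVES THE LEAD. `memberInvariants_of_anacongWt hmu hlam : <stub_memberInvariants, v8 text, token for token>` from
`hmu : KellerYin2024.thm222_anacong_hidaMember_sigma_mu_OPEN` and `hlam : KellerYin2024.thm222_anacong_hidaMember_sigma_lambda_OPEN`,
so a v9/v10 can DROP `stub_memberInvariants` and feed `…OfNamedFactsV8.bsdpOnCellC_of_namedFactsV8`'s `hMember` slot with this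
theorem applied to two new named-fact conjuncts (both `[claim: KellerYin2024]`-tagged like `CharMainConjOnTree`; the `φ ≠ 𝟙` slice
`thm222_anacong_hidaMember_sigma_lambda_of_ne_one` is the composed-refereed-print sibling, bridge `anacongWt_lambda_of_ne_one_of_OPEN`
below). The two conjuncts separately: `memberMuZero_of_anacongWt` (= `.1`) and `memberLambdaCount_of_anacongWt` (= `.2`).

PROOF CONTENT: bookkeeping only — `CellC W p` unfolds to `r_an = 1 ∧ p ≠ 2 ∧ Red W p ∧ Mult W p` (`X2.Cells`,
`Rank1Residual.ClassX2`), `p ≠ 2 ⟹ 2 < p` for a prime; (i) is the `μ`-statement instantiated; (ii′)'s inequality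
`n ≤ 2·nφ + ΣΣ` follows from the `λ`-statement's EQUALITY `n' = 2·nφ' + ΣΣ` by uniqueness of the first unit index
(`n = n'` in `𝓞_{ℂ_p}⟦T⟧`, `nφ = nφ'` by `FirstUnitCoeffAt.unique`).

HONEST FRAMING: IMPLICATIONS between hypothesis-shaped statements; 0 defs, 0 sorry, no new named fact (the two inputs are the
Literature statements, preprint-tagged; their riders (BN), (K34), (CH), (CHp), (H), (Σ), (d′), (a′), (per) are written out in that
file's module docstring); nothing about any curve is asserted; no summit statement / BSD / MC / IMC is proved; 0 cells / labels /
tiers move; the registered stub is NOT closed by this file alone (it becomes derivable from two NAMED statements — the LEAD decides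
whether to reshape).

References: [KellerYin2024] Thm. 2.2.2, Thm. 2.2.1, Prop. 2.1.1, Thm. 2.1.3 (arXiv:2402.12781v2 p. 18); [CastellaGrossiLeeSkinner2022]
Thms. 2.2.1–2.2.2 (arXiv:2008.02571 p. 12); [Kriz2016] Thm. 3, Thm. 34, Rem. 33, Prop. 37 (arXiv:1512.05032); [Hida2010MuInvariant]
Thm. I; [Washington1997] §7.1; cell `Cruxes/BSDpOnCellC/STUB-PLAN-memberInvariants.md` §1, `Lines/crystal.lean` v8.
-/

set_option autoImplicit false
set_option linter.dupNamespace false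

noncomputable section

open scoped Classical MatrixGroups ModularForm

open CongruenceSubgroup WeierstrassCurve NumberField IsDedekindDomain Field PowerSeries
  Literature.NumberTheory.EllipticCurves Literature.NumberTheory.EllipticCurves.GreenbergSelmer
  Literature.NumberTheory.EllipticCurves.ModularForms Literature.NumberTheory.QuadraticFields
  Literature.NumberTheory.EllipticCurves.Rank1Residual
  Literature.NumberTheory.EllipticCurves.Rank1Residual.Typed
  Literature.NumberTheory.EllipticCurves.GreenbergVatsal2000
  Literature.NumberTheory.EllipticCurves.Castella2018
  Literature.NumberTheory.GaloisRepresentations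
  Summit.BirchSwinnertonDyer.Rank1Residual Summit.BirchSwinnertonDyer.Rank1Residual.X2
open Literature.NumberTheory.EllipticCurves.CastellaGrossiLeeSkinner2022
open Literature.NumberTheory.EllipticCurves.KellerYin2024

namespace Summit.BirchSwinnertonDyer.BirchSwinnertonDyer.Theorems.MemberInvariantsOfAnacongWt

/-- `CellC W p` gives `2 < p` (the class `X2` has `p ≠ 2`). [folklore] -/
theorem two_lt_of_cellC {W : WeierstrassCurve ℚ} {p : ℕ} [Fact p.Prime] (h : CellC W p) : 2 < p :=
  lt_of_le_of_ne (Fact.out : p.Prime).two_le (Ne.symm h.2.1)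

/-- `CellC W p` gives `Red W p` (`E[p]` reducible). [folklore] -/
theorem red_of_cellC {W : WeierstrassCurve ℚ} {p : ℕ} [Fact p.Prime] (h : CellC W p) : Red W p :=
  h.2.2.1

/-- `CellC W p` gives multiplicative reduction at `p`. [folklore] -/
theorem mult_of_cellC {W : WeierstrassCurve ℚ} {p : ℕ} [Fact p.Prime] (h : CellC W p) :
    W.HasMultiplicativeReductionAtPrime p :=
  h.2.2.2

/-- The first unit index of a series in `𝓞_{ℂ_p}⟦T⟧` is unique. [cite: Washington1997, §7.1 Prop. 7.2] -/
theorem firstUnitIndex_unique {p : ℕ} [Fact p.Prime] {Q : PowerSeries 𝓞_ℂ_[p]} {m n : ℕ}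
    (hm : ‖((PowerSeries.coeff m Q : 𝓞_ℂ_[p]) : ℂ_[p])‖ = 1 ∧
      ∀ i < m, ‖((PowerSeries.coeff i Q : 𝓞_ℂ_[p]) : ℂ_[p])‖ < 1)
    (hn : ‖((PowerSeries.coeff n Q : 𝓞_ℂ_[p]) : ℂ_[p])‖ = 1 ∧
      ∀ i < n, ‖((PowerSeries.coeff i Q : 𝓞_ℂ_[p]) : ℂ_[p])‖ < 1) : m = n := by
  by_contra h
  rcases Nat.lt_or_gt_of_ne h with h | h
  · exact (hn.2 m h).ne hm.1
  · exact (hm.2 n h).ne hn.1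

/-- **Conjunct (i) of `stub_memberInvariants` (crystal v8), VERBATIM — «every Σ-imprimitive weight-`k₁` frame of a crystalline
member has a first unit coefficient (`μ = 0`)» — from Keller–Yin Thm. 2.2.2's first clause at weight `k`
(`thm222_anacong_hidaMember_sigma_mu_OPEN`) by instantiation (`CellC` ⟹ `2 < p`, `Red`, multiplicative).**
[claim: KellerYin2024, status: under-review] [cite: KellerYin2024, Thm. 2.2.2 first clause (arXiv:2402.12781v2 p. 18)]
[cite: CastellaGrossiLeeSkinner2022, Thm. 2.2.2 (arXiv:2008.02571 p. 12)] [cite: Hida2010MuInvariant, Thm. I] -/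
theorem memberMuZero_of_anacongWt (hmu : thm222_anacong_hidaMember_sigma_mu_OPEN) :
    ∀ (W : WeierstrassCurve ℚ) [W.IsElliptic] [W.IsGloballyMinimal] (p : ℕ) [Fact p.Prime],
      ∀ (N : ℕ) [NeZero N] (K : Type) [Field K] [NumberField K],
        CellC W p → W.conductorNorm ℤ = N →
        IsImaginaryQuadratic K → NumberField.discr K < -4 → SatisfiesHeegnerHypothesis N K →
        Odd (NumberField.discr K) →
        ∀ (κ : ZpExtension K p), κ.IsAnticyclotomic →
          ∀ (γ : Field.absoluteGaloisGroup K) [Fact (κ.IsTopGenerator γ)]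
            (𝔭 : HeightOneSpectrum (𝓞 K)), ((p : ℕ) : 𝓞 K) ∈ 𝔭.asIdeal →
              ((Ideal.span {(p : ℤ)}).primesOver (𝓞 K)).ncard = 2 →
            ∀ (ι' : PadicAlgCl p ≃+* ℂ),
              (∀ (w : InfinitePlace K) (k : 𝓞 K),
                k ∈ 𝔭.asIdeal ↔ ‖ι'.symm (w.embedding (k : K))‖ < 1) →
              ∀ (D : Skinner2016.HidaCongruentForm W p 1), (∀ x : coeffField D.g, ι' (D.ι x) = (x : ℂ)) →
                ∀ (ΩK' : ℂ) (Ωp' : ℂ_[p]) (Qg : PowerSeries 𝓞_ℂ_[p]), ΩK' ≠ 0 → ‖Ωp'‖ = 1 →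
                  IsBDPLFunctionWtSigmaInt ι' 𝔭 κ γ D.g (W.sigmaPlacesFinset p K) ΩK' Ωp' Qg →
                    ∃ n : ℕ, ‖((PowerSeries.coeff n Qg : 𝓞_ℂ_[p]) : ℂ_[p])‖ = 1 ∧
                      ∀ i < n, ‖((PowerSeries.coeff i Qg : 𝓞_ℂ_[p]) : ℂ_[p])‖ < 1 := by
  intro W _ _ p _ N _ K _ _ hC hN hK hdisc hH hodd κ hκ γ _ 𝔭 h𝔭 hsplit ι' hι' D hD ΩK' Ωp' Qg hΩ hΩp hQg
  exact hmu W p (two_lt_of_cellC hC) (red_of_cellC hC) (mult_of_cellC hC) N K hN hK hdisc hH hodd κ hκ γ 𝔭 h𝔭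
    hsplit ι' hι' D hD ΩK' Ωp' Qg hΩ hΩp hQg

/-- **Conjunct (ii′) of `stub_memberInvariants` (crystal v8), VERBATIM — the SIGN-FREE member `λ`-count «`n ≤ 2·n_φ + Σ_{w∈Σ}
(λ𝒫_w(θsub) + λ𝒫_w(θquot))`» — from Keller–Yin Thm. 2.2.2 at weight `k` (`thm222_anacong_hidaMember_sigma_lambda_OPEN`, which
gives the EQUALITY) by instantiation and uniqueness of the first unit index (of `Qg` in `𝓞_{ℂ_p}⟦T⟧`, and of the Katz frame
`Lφ`, `FirstUnitCoeffAt.unique`).**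
[claim: KellerYin2024, status: under-review] [cite: KellerYin2024, Thm. 2.2.2 (arXiv:2402.12781v2 p. 18)]
[cite: CastellaGrossiLeeSkinner2022, Thms. 2.2.1–2.2.2 (arXiv:2008.02571 p. 12)] [cite: Kriz2016, Thm. 3, Thm. 34, Prop. 37]
[cite: Washington1997, §7.1 Prop. 7.2] -/
theorem memberLambdaCount_of_anacongWt (hlam : thm222_anacong_hidaMember_sigma_lambda_OPEN) :
    ∀ (W : WeierstrassCurve ℚ) [W.IsElliptic] [W.IsGloballyMinimal] (p : ℕ) [Fact p.Prime],
      ∀ (N : ℕ) [NeZero N] (K : Type) [Field K] [NumberField K],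
        CellC W p → W.conductorNorm ℤ = N →
        IsImaginaryQuadratic K → NumberField.discr K < -4 → SatisfiesHeegnerHypothesis N K →
        Odd (NumberField.discr K) →
        ∀ (κ : ZpExtension K p), κ.IsAnticyclotomic →
          ∀ (γ : Field.absoluteGaloisGroup K) [Fact (κ.IsTopGenerator γ)]
            (𝔭 : HeightOneSpectrum (𝓞 K)), ((p : ℕ) : 𝓞 K) ∈ 𝔭.asIdeal →
            𝔭.asIdeal.ramificationIdx (𝓞 ℚ) = 1 → 𝔭.asIdeal.inertiaDeg (𝓞 ℚ) = 1 →
            ∀ (𝔭bar : HeightOneSpectrum (𝓞 K)), ((p : ℕ) : 𝓞 K) ∈ 𝔭bar.asIdeal → 𝔭bar ≠ 𝔭 →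
              ((Ideal.span {(p : ℤ)}).primesOver (𝓞 K)).ncard = 2 →
            ∀ (ι' : PadicAlgCl p ≃+* ℂ),
              (∀ (w : InfinitePlace K) (k : 𝓞 K),
                k ∈ 𝔭.asIdeal ↔ ‖ι'.symm (w.embedding (k : K))‖ < 1) →
              ∀ (D : Skinner2016.HidaCongruentForm W p 1), (∀ x : coeffField D.g, ι' (D.ι x) = (x : ℂ)) →
                2 * ((p : ℤ) - 1) ∣ D.k - 2 →
                ∀ (ΩKg : ℂ) (Ωpg : ℂ_[p]) (Qg : PowerSeries 𝓞_ℂ_[p]), ΩKg ≠ 0 → ‖Ωpg‖ = 1 →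
                  IsBDPLFunctionWtSigmaInt ι' 𝔭 κ γ D.g (W.sigmaPlacesFinset p K) ΩKg Ωpg Qg →
                  ∀ (Φ : AddSubgroup (geomTorsion W (p : ℤ))), IsRationalLine W p Φ →
                  ∀ (θsub θquot : FramedGaloisRep ℚ (padicCoeffIntegers (∅ : Set (PadicAlgCl p))) 1),
                    IsTeichmullerLiftOn (∅ : Set (PadicAlgCl p)) (Φ.map (geomTorsion W (p : ℤ)).subtype) θsub →
                    IsTeichmullerLiftOnQuot (∅ : Set (PadicAlgCl p)) (Φ.map (geomTorsion W (p : ℤ)).subtype)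
                      (geomTorsion W (p : ℤ)) θquot →
                  ∀ (φ ψ : FramedGaloisRep ℚ (padicCoeffIntegers (∅ : Set (PadicAlgCl p))) 1),
                    (φ = θsub ∧ ψ = θquot ∨ φ = θquot ∧ ψ = θsub) →
                    (∀ u : HeightOneSpectrum (𝓞 ℚ), ((p : ℕ) : 𝓞 ℚ) ∈ u.asIdeal → φ.IsUnramifiedAt u) →
                  ∀ (θK : HeckeCharacter K), IsHeckeCharOf ι' (φ.restrictField K) θK →
                  ∀ (Cbar : Finset (HeightOneSpectrum (𝓞 K))), (∀ u ∈ Cbar, ¬ θK.IsUnramifiedAt u) →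
                  ∀ (ΩK' : ℂ) (Ωp' : (unrIntegers p)ˣ) (Lφ : UnrSeries p), ΩK' ≠ 0 →
                    IsKatzLFunction ι' 𝔭 𝔭bar Cbar κ γ θK ΩK' ((Ωp' : unrIntegers p) : ℂ_[p]) Lφ →
                  ∀ nφ : ℕ, FirstUnitCoeffAt Lφ nφ →
                  ∀ n : ℕ, ‖((PowerSeries.coeff n Qg : 𝓞_ℂ_[p]) : ℂ_[p])‖ = 1 →
                    (∀ i < n, ‖((PowerSeries.coeff i Qg : 𝓞_ℂ_[p]) : ℂ_[p])‖ < 1) →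
                      n ≤ 2 * nφ + ∑ w ∈ W.sigmaPlacesFinset p K,
                        (charLocalLambda (∅ : Set (PadicAlgCl p)) κ (θsub.restrictField K) w +
                          charLocalLambda (∅ : Set (PadicAlgCl p)) κ (θquot.restrictField K) w) := by
  intro W _ _ p _ N _ K _ _ hC hN hK hdisc hH hodd κ hκ γ _ 𝔭 h𝔭 hram hdeg 𝔭bar h𝔭bar hne hsplit ι' hι' D hD
    hpar ΩKg Ωpg Qg hΩ hΩp hQg Φ hΦ θsub θquot hsub hquot φ ψ hφψ hunr θK hθK Cbar hC' ΩK' Ωp' Lφ hΩ' hLφ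
    nφ hnφ n hn hlt
  obtain ⟨n', nφ', hQ', hL', heq⟩ := hlam W p (two_lt_of_cellC hC) (mult_of_cellC hC) N K hN hK hdisc hH hodd κ
    hκ γ 𝔭 h𝔭 hram hdeg 𝔭bar h𝔭bar hne hsplit ι' hι' D hD hpar ΩKg Ωpg Qg hΩ hΩp hQg Φ hΦ θsub θquot hsub hquot
    φ ψ hφψ hunr θK hθK Cbar hC' ΩK' Ωp' Lφ hΩ' hLφ
  have h1 : n = n' := firstUnitIndex_unique ⟨hn, hlt⟩ hQ'
  have h2 : nφ = nφ' := hnφ.unique hL'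
  subst h1 h2
  exact heq.le

/-- **`stub_memberInvariants` of crystal v8 (crux 4 `BSDpOnCellC`, stmt-BirchSwinnertonDyer-19034), ITS REGISTERED TEXT TOKEN FOR TOKEN,
from the two weight-`k` named statements** — the LEAD's by-name plug: `…OfNamedFactsV8.bsdpOnCellC_of_namedFactsV8 … (memberInvariants_of_anacongWt hmu hlam) …`.
[claim: KellerYin2024, status: under-review] [cite: KellerYin2024, Thm. 2.2.2 (arXiv:2402.12781v2 p. 18)]
[cite: CastellaGrossiLeeSkinner2022, Thms. 2.2.1–2.2.2 (arXiv:2008.02571 p. 12)] [cite: Kriz2016, Thm. 3, Thm. 34, Prop. 37] -/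
theorem memberInvariants_of_anacongWt (hmu : thm222_anacong_hidaMember_sigma_mu_OPEN)
    (hlam : thm222_anacong_hidaMember_sigma_lambda_OPEN) :
    (∀ (W : WeierstrassCurve ℚ) [W.IsElliptic] [W.IsGloballyMinimal] (p : ℕ) [Fact p.Prime],
      ∀ (N : ℕ) [NeZero N] (K : Type) [Field K] [NumberField K],
        CellC W p → W.conductorNorm ℤ = N →
        IsImaginaryQuadratic K → NumberField.discr K < -4 → SatisfiesHeegnerHypothesis N K →
        Odd (NumberField.discr K) →
        ∀ (κ : ZpExtension K p), κ.IsAnticyclotomic →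
          ∀ (γ : Field.absoluteGaloisGroup K) [Fact (κ.IsTopGenerator γ)]
            (𝔭 : HeightOneSpectrum (𝓞 K)), ((p : ℕ) : 𝓞 K) ∈ 𝔭.asIdeal →
              ((Ideal.span {(p : ℤ)}).primesOver (𝓞 K)).ncard = 2 →
            ∀ (ι' : PadicAlgCl p ≃+* ℂ),
              (∀ (w : InfinitePlace K) (k : 𝓞 K),
                k ∈ 𝔭.asIdeal ↔ ‖ι'.symm (w.embedding (k : K))‖ < 1) →
              ∀ (D : Skinner2016.HidaCongruentForm W p 1), (∀ x : coeffField D.g, ι' (D.ι x) = (x : ℂ)) →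
                ∀ (ΩK' : ℂ) (Ωp' : ℂ_[p]) (Qg : PowerSeries 𝓞_ℂ_[p]), ΩK' ≠ 0 → ‖Ωp'‖ = 1 →
                  IsBDPLFunctionWtSigmaInt ι' 𝔭 κ γ D.g (W.sigmaPlacesFinset p K) ΩK' Ωp' Qg →
                    ∃ n : ℕ, ‖((PowerSeries.coeff n Qg : 𝓞_ℂ_[p]) : ℂ_[p])‖ = 1 ∧
                      ∀ i < n, ‖((PowerSeries.coeff i Qg : 𝓞_ℂ_[p]) : ℂ_[p])‖ < 1) ∧
    (∀ (W : WeierstrassCurve ℚ) [W.IsElliptic] [W.IsGloballyMinimal] (p : ℕ) [Fact p.Prime],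
      ∀ (N : ℕ) [NeZero N] (K : Type) [Field K] [NumberField K],
        CellC W p → W.conductorNorm ℤ = N →
        IsImaginaryQuadratic K → NumberField.discr K < -4 → SatisfiesHeegnerHypothesis N K →
        Odd (NumberField.discr K) →
        ∀ (κ : ZpExtension K p), κ.IsAnticyclotomic →
          ∀ (γ : Field.absoluteGaloisGroup K) [Fact (κ.IsTopGenerator γ)]
            (𝔭 : HeightOneSpectrum (𝓞 K)), ((p : ℕ) : 𝓞 K) ∈ 𝔭.asIdeal →
            𝔭.asIdeal.ramificationIdx (𝓞 ℚ) = 1 → 𝔭.asIdeal.inertiaDeg (𝓞 ℚ) = 1 →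
            ∀ (𝔭bar : HeightOneSpectrum (𝓞 K)), ((p : ℕ) : 𝓞 K) ∈ 𝔭bar.asIdeal → 𝔭bar ≠ 𝔭 →
              ((Ideal.span {(p : ℤ)}).primesOver (𝓞 K)).ncard = 2 →
            ∀ (ι' : PadicAlgCl p ≃+* ℂ),
              (∀ (w : InfinitePlace K) (k : 𝓞 K),
                k ∈ 𝔭.asIdeal ↔ ‖ι'.symm (w.embedding (k : K))‖ < 1) →
              ∀ (D : Skinner2016.HidaCongruentForm W p 1), (∀ x : coeffField D.g, ι' (D.ι x) = (x : ℂ)) →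
                2 * ((p : ℤ) - 1) ∣ D.k - 2 →
                ∀ (ΩKg : ℂ) (Ωpg : ℂ_[p]) (Qg : PowerSeries 𝓞_ℂ_[p]), ΩKg ≠ 0 → ‖Ωpg‖ = 1 →
                  IsBDPLFunctionWtSigmaInt ι' 𝔭 κ γ D.g (W.sigmaPlacesFinset p K) ΩKg Ωpg Qg →
                  ∀ (Φ : AddSubgroup (geomTorsion W (p : ℤ))), IsRationalLine W p Φ →
                  ∀ (θsub θquot : FramedGaloisRep ℚ (padicCoeffIntegers (∅ : Set (PadicAlgCl p))) 1),
                    IsTeichmullerLiftOn (∅ : Set (PadicAlgCl p)) (Φ.map (geomTorsion W (p : ℤ)).subtype) θsub →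
                    IsTeichmullerLiftOnQuot (∅ : Set (PadicAlgCl p)) (Φ.map (geomTorsion W (p : ℤ)).subtype)
                      (geomTorsion W (p : ℤ)) θquot →
                  ∀ (φ ψ : FramedGaloisRep ℚ (padicCoeffIntegers (∅ : Set (PadicAlgCl p))) 1),
                    (φ = θsub ∧ ψ = θquot ∨ φ = θquot ∧ ψ = θsub) →
                    (∀ u : HeightOneSpectrum (𝓞 ℚ), ((p : ℕ) : 𝓞 ℚ) ∈ u.asIdeal → φ.IsUnramifiedAt u) →
                  ∀ (θK : HeckeCharacter K), IsHeckeCharOf ι' (φ.restrictField K) θK →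
                  ∀ (Cbar : Finset (HeightOneSpectrum (𝓞 K))), (∀ u ∈ Cbar, ¬ θK.IsUnramifiedAt u) →
                  ∀ (ΩK' : ℂ) (Ωp' : (unrIntegers p)ˣ) (Lφ : UnrSeries p), ΩK' ≠ 0 →
                    IsKatzLFunction ι' 𝔭 𝔭bar Cbar κ γ θK ΩK' ((Ωp' : unrIntegers p) : ℂ_[p]) Lφ →
                  ∀ nφ : ℕ, FirstUnitCoeffAt Lφ nφ →
                  ∀ n : ℕ, ‖((PowerSeries.coeff n Qg : 𝓞_ℂ_[p]) : ℂ_[p])‖ = 1 →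
                    (∀ i < n, ‖((PowerSeries.coeff i Qg : 𝓞_ℂ_[p]) : ℂ_[p])‖ < 1) →
                      n ≤ 2 * nφ + ∑ w ∈ W.sigmaPlacesFinset p K,
                        (charLocalLambda (∅ : Set (PadicAlgCl p)) κ (θsub.restrictField K) w +
                          charLocalLambda (∅ : Set (PadicAlgCl p)) κ (θquot.restrictField K) w)) :=
  ⟨memberMuZero_of_anacongWt hmu, memberLambdaCount_of_anacongWt hlam⟩

/-- **Bridge (bookkeeping):** the preprint-tagged weight-`k` `λ`-statement CONTAINS its `φ ≠ 𝟙` slice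
(`thm222_anacong_hidaMember_sigma_lambda_of_ne_one`, the composed-refereed-print sibling) — dropping «`φ ≠ 𝟙`» from [CGLS]
Thm. 2.2.2 is exactly what [KY24] Thm. 2.2.2 asserts. [cite: KellerYin2024, Thm. 2.2.2 (arXiv:2402.12781v2 p. 18)]
[cite: CastellaGrossiLeeSkinner2022, Thm. 2.2.2] -/
theorem anacongWt_lambda_of_ne_one_of_OPEN (h : thm222_anacong_hidaMember_sigma_lambda_OPEN) :
    thm222_anacong_hidaMember_sigma_lambda_of_ne_one :=
  fun W _ _ p _ hp hmult N _ K _ _ hN hK hdisc hH hodd κ hκ γ _ 𝔭 h𝔭 hram hdeg 𝔭bar h𝔭bar hne hsplit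
      ι' hι' D hD hpar ΩKg Ωpg Qg hΩKg hΩpg hQg Φ hΦ θsub θquot hsub hquot φ ψ hφψ hunr _ θK hθK Cbar hC
      ΩK' Ωp' Lφ hΩK' hLφ ↦
    h W p hp hmult N K hN hK hdisc hH hodd κ hκ γ 𝔭 h𝔭 hram hdeg 𝔭bar h𝔭bar hne hsplit ι' hι' D hD hpar
      ΩKg Ωpg Qg hΩKg hΩpg hQg Φ hΦ θsub θquot hsub hquot φ ψ hφψ hunr θK hθK Cbar hC ΩK' Ωp' Lφ hΩK' hLφ

/-- **Bridge (bookkeeping):** on the `λ`-statement's own binders the `μ`-conclusion for the same frame is its first conjunct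
(a consumer holding the character data need not cite the `μ`-statement separately). [cite: KellerYin2024, Thm. 2.2.2 (arXiv:2402.12781v2 p. 18)] -/
theorem exists_firstUnitIndex_of_anacongWt_lambda (h : thm222_anacong_hidaMember_sigma_lambda_OPEN)
    (W : WeierstrassCurve ℚ) [W.IsElliptic] [W.IsGloballyMinimal] (p : ℕ) [Fact p.Prime]
    (hp : 2 < p) (hmult : W.HasMultiplicativeReductionAtPrime p)
    (N : ℕ) [NeZero N] (K : Type) [Field K] [NumberField K]
    (hN : W.conductorNorm ℤ = N) (hK : IsImaginaryQuadratic K) (hdisc : NumberField.discr K < -4)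
    (hH : SatisfiesHeegnerHypothesis N K) (hodd : Odd (NumberField.discr K))
    (κ : ZpExtension K p) (hκ : κ.IsAnticyclotomic)
    (γ : Field.absoluteGaloisGroup K) [Fact (κ.IsTopGenerator γ)]
    (𝔭 : HeightOneSpectrum (𝓞 K)) (h𝔭 : ((p : ℕ) : 𝓞 K) ∈ 𝔭.asIdeal)
    (hram : 𝔭.asIdeal.ramificationIdx (𝓞 ℚ) = 1) (hdeg : 𝔭.asIdeal.inertiaDeg (𝓞 ℚ) = 1)
    (𝔭bar : HeightOneSpectrum (𝓞 K)) (h𝔭bar : ((p : ℕ) : 𝓞 K) ∈ 𝔭bar.asIdeal) (hne : 𝔭bar ≠ 𝔭)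
    (hsplit : ((Ideal.span {(p : ℤ)}).primesOver (𝓞 K)).ncard = 2)
    (ι' : PadicAlgCl p ≃+* ℂ)
    (hι' : ∀ (w : InfinitePlace K) (k : 𝓞 K), k ∈ 𝔭.asIdeal ↔ ‖ι'.symm (w.embedding (k : K))‖ < 1)
    (D : Skinner2016.HidaCongruentForm W p 1) (hD : ∀ x : coeffField D.g, ι' (D.ι x) = (x : ℂ))
    (hpar : 2 * ((p : ℤ) - 1) ∣ D.k - 2)
    (ΩKg : ℂ) (Ωpg : ℂ_[p]) (Qg : PowerSeries 𝓞_ℂ_[p]) (hΩKg : ΩKg ≠ 0) (hΩpg : ‖Ωpg‖ = 1)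
    (hQg : IsBDPLFunctionWtSigmaInt ι' 𝔭 κ γ D.g (W.sigmaPlacesFinset p K) ΩKg Ωpg Qg)
    (Φ : AddSubgroup (geomTorsion W (p : ℤ))) (hΦ : IsRationalLine W p Φ)
    (θsub θquot : FramedGaloisRep ℚ (padicCoeffIntegers (∅ : Set (PadicAlgCl p))) 1)
    (hsub : IsTeichmullerLiftOn (∅ : Set (PadicAlgCl p)) (Φ.map (geomTorsion W (p : ℤ)).subtype) θsub)
    (hquot : IsTeichmullerLiftOnQuot (∅ : Set (PadicAlgCl p)) (Φ.map (geomTorsion W (p : ℤ)).subtype)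
      (geomTorsion W (p : ℤ)) θquot)
    (φ ψ : FramedGaloisRep ℚ (padicCoeffIntegers (∅ : Set (PadicAlgCl p))) 1)
    (hφψ : φ = θsub ∧ ψ = θquot ∨ φ = θquot ∧ ψ = θsub)
    (hunr : ∀ u : HeightOneSpectrum (𝓞 ℚ), ((p : ℕ) : 𝓞 ℚ) ∈ u.asIdeal → φ.IsUnramifiedAt u)
    (θK : HeckeCharacter K) (hθK : IsHeckeCharOf ι' (φ.restrictField K) θK)
    (Cbar : Finset (HeightOneSpectrum (𝓞 K))) (hC : ∀ u ∈ Cbar, ¬ θK.IsUnramifiedAt u)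
    (ΩK' : ℂ) (Ωp' : (unrIntegers p)ˣ) (Lφ : UnrSeries p) (hΩK' : ΩK' ≠ 0)
    (hLφ : IsKatzLFunction ι' 𝔭 𝔭bar Cbar κ γ θK ΩK' ((Ωp' : unrIntegers p) : ℂ_[p]) Lφ) :
    ∃ n : ℕ, ‖((PowerSeries.coeff n Qg : 𝓞_ℂ_[p]) : ℂ_[p])‖ = 1 ∧
      ∀ i < n, ‖((PowerSeries.coeff i Qg : 𝓞_ℂ_[p]) : ℂ_[p])‖ < 1 := by
  obtain ⟨n, -, hQ, -, -⟩ := h W p hp hmult N K hN hK hdisc hH hodd κ hκ γ 𝔭 h𝔭 hram hdeg 𝔭bar h𝔭bar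
    hne hsplit ι' hι' D hD hpar ΩKg Ωpg Qg hΩKg hΩpg hQg Φ hΦ θsub θquot hsub hquot φ ψ hφψ hunr θK hθK
    Cbar hC ΩK' Ωp' Lφ hΩK' hLφ
  exact ⟨n, hQ⟩

end Summit.BirchSwinnertonDyer.BirchSwinnertonDyer.Theorems.MemberInvariantsOfAnacongWt

end
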